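import Mathlib.AlgebraicGeometry.IdealSheaf.Functorial
import Mathlib.AlgebraicGeometry.Morphisms.Flat
import HarnessLib

/-!
# (γ♯) From an ideal sheaf on the thickening to the lifted closed subscheme

OURS · L1 W4.5b · EL♮(3) `stmt-ResolutionOfSingularities-20148` · J1c (β) scheme plumbing · counted 0 (res-type-027 g16).
The conclusion of J1 = `EmbeddedInfinitesimalLiftFact` (…NatEmbeddedInfinitesimalLiftFactDefs, p596985) asks for a closed subscheme
`Yₙ' ↪ Wₙ₊₁`, flat over the base, whose pullback along the transition `t : Wₙ ↪ Wₙ₊₁` is the given `Yₙ ↪ Wₙ`. This file reduces that to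
IDEAL-SHEAF currency: it suffices to produce `C : Wₙ₊₁.IdealSheafData` with `C.comap t = ker (Yₙ ↪ Wₙ)` and `V(C) → base` flat
(Mathlib `isPullback_of_isClosedImmersion`, `IsClosedImmersion.lift`). [folklore]
-/

noncomputable section

open CategoryTheory CategoryTheory.Limits AlgebraicGeometry

namespace Summit.ResolutionOfSingularities.ResolutionOfSingularities.Cruxes.EquisingularLiftNat.Sections

/-- **(γ♯)** Given `t : Wₙ ⟶ Wₙ₊₁`, `p : Wₙ₊₁ ⟶ B`, a closed immersion `jn : Yₙ ⟶ Wₙ` and an ideal sheaf `C` on `Wₙ₊₁` with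
`C.comap t = jn.ker` and `V(C) → B` flat, the closed subscheme `V(C) ↪ Wₙ₊₁` is a flat lift of `Yₙ`: there is `s : Yₙ ⟶ V(C)` making
`Yₙ = V(C) ×_{Wₙ₊₁} Wₙ`. [folklore] -/
theorem exists_closedImmersion_flat_isPullback_of_idealSheafData {Wn Wn₁ B Yn : Scheme.{0}} (t : Wn ⟶ Wn₁) (p : Wn₁ ⟶ B)
    (jn : Yn ⟶ Wn) [IsClosedImmersion jn] (C : Wn₁.IdealSheafData) (hC : C.comap t = jn.ker)
    (hflat : Flat (C.subschemeι ≫ p)) :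
    ∃ (Yn' : Scheme.{0}) (jn' : Yn' ⟶ Wn₁) (s : Yn ⟶ Yn'),
      IsClosedImmersion jn' ∧ Flat (jn' ≫ p) ∧ IsPullback s jn jn' t := by
  have hle : C.subschemeι.ker ≤ (jn ≫ t).ker := by
    rw [Scheme.IdealSheafData.ker_subschemeι, ← Scheme.IdealSheafData.map_ker, ← hC]
    exact C.le_map_comap t
  refine ⟨C.subscheme, C.subschemeι, IsClosedImmersion.lift C.subschemeι (jn ≫ t) hle, inferInstance, hflat, ?_⟩
  exact (isPullback_of_isClosedImmersion jn C.subschemeι (IsClosedImmersion.lift C.subschemeι (jn ≫ t) hle) t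
    (by rw [IsClosedImmersion.lift_fac]) (by rw [Scheme.IdealSheafData.ker_subschemeι, hC])).flip

/-- **(γ♯), kernel form.** Conversely-shaped bookkeeping: if `IsPullback s jn jn' t` with `jn'` a closed immersion then
`jn'.ker.comap t = jn.ker` (Mathlib `ker_fst_of_isClosedImmersion` transported along the pullback iso). [folklore] -/
theorem ker_comap_eq_of_isPullback {Wn Wn₁ Yn Yn' : Scheme.{0}} {t : Wn ⟶ Wn₁} {jn : Yn ⟶ Wn} {jn' : Yn' ⟶ Wn₁} {s : Yn ⟶ Yn'}
    [IsClosedImmersion jn'] (h : IsPullback s jn jn' t) : jn'.ker.comap t = jn.ker := by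
  rw [← Scheme.IdealSheafData.ker_fst_of_isClosedImmersion jn' t, ← h.flip.isoPullback_hom_fst, Scheme.Hom.ker_comp_of_isIso]

end Summit.ResolutionOfSingularities.ResolutionOfSingularities.Cruxes.EquisingularLiftNat.Sections

end
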